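import Literature.Computability.QuantumComplexity.QAOALevelOneMaxCut
import HarnessLib

/-!
# Symmetry protection for QAOA on the ring of disagrees (Bravyi–Kliesch–Koenig–Tang 2020, Theorem 2)

Topic `Literature/Computability/QuantumComplexity` (pub-qadeq lane); companion to
`QAOALevelOneMaxCut.lean` (FGG 2014 / WHJR 2018: the QAOA objects `qaoaUnitaryP`, `levelP`, `meanCut`,
`maxLevel`, the light cone `lightCone`, the product-state factorisation `trace_mul_mul_initialState`),
kept in its own file because the parent file is at the gate's size limit. This file PROVES the first
rigorous all-level limitation on QAOA for MaxCut in the tree: the upper bound of BKKT's Theorem 2 —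
every ℤ₂-symmetric unitary of range `R < n/4` on an even ring of `n` qubits has ring-of-disagrees
energy at most `n(2R + ½)/(2R + 1)` — together with its premises for QAOA (the level-`p` circuit is
ℤ₂-symmetric and has range `p`), whence `F_p(γ,β) ≤ M_p ≤ n(2p + ½)/(2p + 1)` on even rings with
`n > 4p`.

HONEST FRAMING: instance-level adjudication of specific advantage claims; no claim about BQP vs
BPP or the summit. This is a limitation of one family of variational circuits on one family of
instances, exactly as printed; it says nothing about other ansätze, other instances, or any device.

## Sources (held texts, read at the cited places)

* [BravyiKlieschKoenigTang2020] S. Bravyi, A. Kliesch, R. Koenig, E. Tang, *Obstacles to Variational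
  Quantum Optimization from Symmetry Protection*, Phys. Rev. Lett. 125, 260505 (2020) =
  arXiv:1910.08980 (`lit read arxiv:1910.08980`, tex chunks p0002–p0004; the held text is the tex
  source, displays cited by position). Introduction: “a quantum circuit `U` acting on `n` qubits is
  said to be ℤ₂-symmetric if it obeys `U X^{⊗n} = X^{⊗n} U`”, “a state `Ψ` of `n` qubits is
  ℤ₂-symmetric if `X^{⊗n}Ψ = ±Ψ`”; “`H_n = ½ Σ_{(u,v)∈E} (I − Z_uZ_v)` … Clearly, `H_n` is
  ℤ₂-symmetric”; “Note that `p(x) = p(x̄)` since `Uφ` is ℤ₂-symmetric”. QAOA paragraph: “Crucially,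
  the QAOA circuit `U(β,γ)` with the Hamiltonian `H_n` as well as the initial QAOA state `|+^n⟩` obey
  the ℤ₂-symmetry property”; “a unitary `U` acting on `n` qubits located at vertices of the cycle
  graph has range `R` if the operator `U†Z_jU` has support on the interval `[j−R, j+R]` for any qubit
  `j`. For example, the level-`p` QAOA circuit associated with the ring of disagrees has range
  `R = p`.” **Theorem 2.** “Let `H_n = ½ Σ_{p∈ℤ_n}(I − Z_pZ_{p+1})` be the ring of disagrees
  Hamiltonian, where `n` is even. Let `U` be a ℤ₂-symmetric unitary with range `R < n/4`. Then
  `(1/n)⟨+^n|U†H_nU|+^n⟩ ≤ (2R + 1/2)/(2R + 1)`. This bound is tight whenever `n` is a multiple of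
  `2R + 1`.” Proof of the upper bound: “Define `X̄ = (XI)^{⊗n/2}`. Then `X̄H_nX̄ + H_n = nI`. Let
  `V = X̄U`. Note that `V` is a ℤ₂ symmetric circuit with range `R`. Taking the expected value … it
  suffices to prove that `(1/n)⟨+^n|V†H_nV|+^n⟩ ≥ 1 − (2R+1/2)/(2R+1) = 1/(2(2R+1))` … define
  `ε_{j,k} = ½⟨+^n|V†(I − Z_jZ_k)V|+^n⟩` … We claim that `ε_{j,k} = ½` if `dist(j,k) > 2R`. Indeed,
  `⟨+^n|V†Z_iV|+^n⟩ = 0` for any qubit `i` since `V|+^n⟩` and `Z_iV|+^n⟩` are eigenvectors of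
  `X^{⊗n}` with eigenvalues `1` and `−1`. Such eigenvectors have to be orthogonal. From
  `dist(j,k) > 2R` one infers that `V†Z_jV` and `V†Z_kV` have disjoint support. Thus
  `⟨+^n|V†Z_jZ_kV|+^n⟩ = ⟨+^n|(V†Z_jV)(V†Z_kV)|+^n⟩ = ⟨+^n|V†Z_jV|+^n⟩·⟨+^n|V†Z_kV|+^n⟩ = 0` …
  `ε_{j,k}` is the probability that the measured values on qubits `j` and `k` disagree. By the union
  bound, `ε_{j,k} ≤ Σ_{i=j}^{k−1} ε_{i,i+1}`. Indeed, if qubits `j` and `k` disagree, at least one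
  pair of consecutive qubits located in the interval `[j,k]` must disagree. Set `k = j + 2R + 1`.
  Then `ε_{j,k} = 1/2` … Take the expected value … with respect to random uniform `j ∈ ℤ_n`. This
  gives `½ ≤ ((2R+1)/n) Σ_{i∈ℤ_n} ε_{i,i+1} = ((2R+1)/n)⟨+^n|V†H_nV|+^n⟩`.”
* [FarhiGoldstoneGutmann2014] E. Farhi, J. Goldstone, S. Gutmann, arXiv:1411.4028, §4: “Regular of
  degree 2 (and connected) means that the graph is a ring”; the QAOA objects are those of
  `QAOALevelOneMaxCut.lean`.

## What is formalised, and how the printed proof is followed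

Register `V → Bool` (any finite `V` for the symmetry section; `V = ZMod n` for the ring), in the
parent file's vocabulary.

* Section `Symmetry`: `globalFlip = X^{⊗n}`; `pauliString_mul_pauliString_mul_pauliString`
  (conjugating a Pauli string by a Pauli string multiplies it by the product of the letterwise signs
  — the tree's `Pauli.mat_mul_mat_mul_mat` sitewise); `commute_globalFlip_edgeTerm` (“`H_n` is
  ℤ₂-symmetric”), `commute_globalFlip_costUnitary` / `commute_globalFlip_mixUnitary` (via the parent's
  exponential forms and `Commute.exp_right`), **`commute_globalFlip_qaoaUnitaryP`** (“the QAOA circuit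
  … obey[s] the ℤ₂-symmetry property”), `globalFlip_mul_initialState_mul_globalFlip` (“as well as the
  initial QAOA state `|+^n⟩`”); **`trace_sitePauli_Z_mul_conj_eq_zero`** (“`⟨+^n|V†Z_iV|+^n⟩ = 0` for
  any qubit `i`”, proved as `tr[Z ρ] = tr[Z X̂ρX̂] = tr[(X̂ZX̂)ρ] = −tr[Zρ]`), for QAOA
  `trace_sitePauli_Z_mul_finalStateP`; `stateVec W = W|s⟩`, `trace_diagonal_mul_conj` (real diagonal
  expectations as `Σ_z d(z)|⟨z|W s⟩|²`), `disagree W a b` = `ε_{a,b}` (“the probability that the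
  measured values on qubits `j` and `k` disagree”, `trace_edgeTerm_mul_conj`).
* Section `RingObstruction` on `ℤ_n` (`ZMod n`): `ringHam n = H_n = Σ_{i∈ℤ_n} ½(1 − Z_iZ_{i+1})`,
  `ringEnergy W = Σ_i ε_{i,i+1} = ⟨W s|H_n|W s⟩` (`trace_ringHam_mul_conj`), `interval R j = [j−R, j+R]`,
  **`HasRange R W`** (every `W†Z_jW` involves only `[j−R, j+R]`, with the parent's `ActsWithin`),
  `disjoint_interval` (`[j−R,j+R] ∩ [k−R,k+R] = ∅` for `k = j+2R+1`, `n ≥ 4R+2`),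
  `trace_ZZ_mul_conj_eq_zero` and **`disagree_far`** (`ε_{j,j+2R+1} = ½`: the printed factorisation,
  by the parent's `trace_mul_mul_initialState`, times the symmetry zero), **`disagree_le_sum`** (the
  union bound, as the pointwise inequality `[z_j ≠ z_{j+m}] ≤ Σ_{t<m} [z_{j+t} ≠ z_{j+t+1}]` integrated
  against `|⟨z|W s⟩|²`), `sum_disagree_le` (averaging over `j ∈ ℤ_n` by translation,
  `Equiv.addRight`), **`ringEnergy_ge`** (`n/2 ≤ (2R+1)⟨V†H_nV⟩`); `altFlip n = X̄ = (XI)^{⊗n/2}` (`X`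
  on the sites of even residue), `altFlip_mul_edgeTerm_mul_altFlip` (`X̄ C_{i,i+1} X̄ = 1 − C_{i,i+1}`,
  consecutive residues having opposite parity on an even ring, `even_val_add_one`),
  **`altFlip_mul_ringHam_mul_altFlip_add`** (`X̄H_nX̄ + H_n = nI`), `hasRange_altFlip_mul` and the
  symmetry of `V = X̄U`; **`ringEnergy_le`** (Theorem 2, absolute form `⟨+^n|U†H_nU|+^n⟩ ≤ n(2R+½)/(2R+1)`)
  and **`ringEnergy_div_le`** (as printed, `(1/n)⟨…⟩ ≤ (2R+½)/(2R+1)`), hypotheses: `n` even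
  (`Even n`), `4R < n` (“`R < n/4`”), `U†U = 1`, `U X^{⊗n} = X^{⊗n} U`, range `R`.
* For QAOA: `ringGraph n` (the cycle on `ℤ_n`, FGG's ring), `costOp_ringGraph` (`C = H_n` for
  `n ≥ 3`), `ball_ringGraph_subset_interval` and **`hasRange_qaoaUnitaryP`** (“the level-`p` QAOA
  circuit associated with the ring of disagrees has range `R = p`”, from the parent's `lightCone`),
  `meanCut_ringGraph` (`F_p = ⟨U†H_nU⟩`), **`meanCut_ringGraph_le`** (`F_p(γ,β) ≤ n(2p+½)/(2p+1)` for
  all angles) and **`maxLevel_ringGraph_le`** (`M_p ≤ n(2p+½)/(2p+1)`), for `n` even, `0 < p`,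
  `4p < n`.
* (v2) **Level 1 on the ring, FGG §4: `M₁ = 3n/4`** — `ringGraph_isRegularOfDegree` (2-regular,
  `n ≥ 3`), `ringGraph_cliqueFree_three` (`n ≥ 4`), `card_edgeFinset_ringGraph` (`n` edges),
  `meanCut_ringGraph_one` (`F₁ = n · F_edge(d=1)`), **`maxLevel_ringGraph_one`** (`M₁ = 3n/4`, from the
  parent's `regularEdge_one_le` / `regularEdge_one_optimal`).
* (v3) **approximation-ratio forms**: `maxCut_eq_card_of_twoColouring` (“any bipartite graph … has
  maximum cut size |E|”), `maxCut_ringGraph` (even ring: MaxCut = n), `maxLevel_ringGraph_le_ratio`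
  (`M_p ≤ ((2p+½)/(2p+1))·MaxCut`), `maxLevel_ringGraph_one_ratio` (`M₁ = ¾·MaxCut`).
* NOT formalised: the tightness half of Theorem 2 (Appendix B's GHZ-segment circuit), BKKT's Theorem 1
  (symmetric NLTS) and Corollary 1 (the `5/6 + √(D−1)/(3D)` bound for bipartite expanders, which needs
  explicit Ramanujan graphs), the recursive QAOA (RQAOA) material, and the conjectured QAOA-specific
  value `(2p+1)/(2p+2)`.

0 named facts, 0 sorry.
-/

noncomputable section

open Matrix Finset

namespace Literature.Computability.QuantumComplexity

namespace QAOA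

variable {V : Type*} [Fintype V] [DecidableEq V]

/-! ### Local copies of the parent file's private plumbing -/

omit [Fintype V] in
/-- Letters of the single-site word. [folklore] -/
private theorem siteWord_apply (Q : Pauli) (w i : V) : siteWord Q w i = if i = w then Q else Pauli.I := by
  unfold siteWord; by_cases h : i = w
  · subst h; simp
  · simp [h]

/-- Scalar multiples of operators involving only `S` involve only `S`. [folklore] -/
private theorem ActsWithin.smul {S : Finset V} {A : Matrix (V → Bool) (V → Bool) ℂ} (hA : ActsWithin S A)
    (c : ℂ) : ActsWithin S (c • A) :=
  fun w hw Q => (hA w hw Q).smul_right c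

variable (G : SimpleGraph V) [DecidableRel G.Adj]

/-- Membership in `S ∪ N(S)`. [folklore] -/
private theorem mem_nbhd_iff {S : Finset V} {b : V} : b ∈ nbhd G S ↔ b ∈ S ∨ ∃ a ∈ S, G.Adj a b := by
  simp only [nbhd, Finset.mem_union, Finset.mem_biUnion, SimpleGraph.mem_neighborFinset]

/-- `N` is monotone. [folklore] -/
private theorem nbhd_mono {S T : Finset V} (h : S ⊆ T) : nbhd G S ⊆ nbhd G T := by
  intro b hb
  rw [mem_nbhd_iff] at hb ⊢
  rcases hb with hb | ⟨a, ha, hab⟩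
  · exact Or.inl (h hb)
  · exact Or.inr ⟨a, h ha, hab⟩

/-- `B_0(S) = S`. [folklore] -/
private theorem ball_zero (S : Finset V) : ball G 0 S = S := rfl

/-- `B_{k+1}(S) = N(B_k(S))`. [folklore] -/
private theorem ball_succ' (k : ℕ) (S : Finset V) : ball G (k + 1) S = nbhd G (ball G k S) := by
  rw [ball, ball, Function.iterate_succ_apply']

/-- Balls grow with the radius. [folklore] -/
private theorem ball_mono {k p : ℕ} (hkp : k ≤ p) (S : Finset V) : ball G k S ⊆ ball G p S := by
  induction p, hkp using Nat.le_induction with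
  | base => exact subset_refl _
  | succ p _ ih => rw [ball_succ']; exact ih.trans Finset.subset_union_left

section Symmetry

/-! ## The `ℤ₂` symmetry of QAOA for MaxCut (Bravyi–Kliesch–Koenig–Tang 2020)

BKKT: “a quantum circuit `U` acting on `n` qubits is said to be ℤ₂-symmetric if it obeys
`U X^{⊗n} = X^{⊗n} U`”, “a state `Ψ` of `n` qubits is ℤ₂-symmetric if `X^{⊗n}Ψ = ±Ψ`”, and
“Crucially, the QAOA circuit `U(β,γ)` with the Hamiltonian `H_n` as well as the initial QAOA state
`|+^n⟩` obey the ℤ₂-symmetry property”; “Note that `p(x) = p(x̄)` since `Uφ` is ℤ₂-symmetric.” -/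

/-- **The global bit flip `X^{⊗n}`.** [cite: BravyiKlieschKoenigTang2020, Introduction (eq. “U X^{⊗n}
= X^{⊗n} U”)] -/
def globalFlip : Matrix (V → Bool) (V → Bool) ℂ := pauliString fun _ : V => Pauli.X

omit [DecidableEq V] in
/-- Plumbing: `⊗ (cᵢ • Aᵢ) = (∏ cᵢ) • ⊗ Aᵢ`. [folklore] -/
private theorem tensorAll_smul_fun (c : V → ℂ) (A : V → Matrix Bool Bool ℂ) :
    tensorAll (fun i => c i • A i) = (∏ i, c i) • tensorAll A := by
  ext x y
  simp only [tensorAll_apply, Matrix.smul_apply, smul_eq_mul, Finset.prod_mul_distrib]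

/-- **Conjugating a Pauli string by a Pauli string multiplies it by the product of the letterwise
signs:** `T S T = (∏ᵢ sign(Tᵢ, Sᵢ)) S`. [cite: BravyiKlieschKoenigTang2020, proof of Thm. 2 (“V =
X̄U … is a ℤ₂ symmetric circuit with range R”, X̄ = (XI)^{⊗n/2})] -/
theorem pauliString_mul_pauliString_mul_pauliString (T S : V → Pauli) :
    pauliString T * pauliString S * pauliString T = (∏ i, Pauli.sign (T i) (S i)) • pauliString S := by
  rw [pauliString_eq, pauliString_eq, tensorAll_mul, tensorAll_mul]
  simp_rw [Pauli.mat_mul_mat_mul_mat]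
  exact tensorAll_smul_fun _ _

/-- `X^{⊗n} X^{⊗n} = 1`. [cite: BravyiKlieschKoenigTang2020, Introduction (X^{⊗n})] -/
theorem globalFlip_mul_self : (globalFlip : Matrix (V → Bool) (V → Bool) ℂ) * globalFlip = 1 :=
  pauliString_mul_self _

omit [DecidableEq V] in
/-- `(X^{⊗n})† = X^{⊗n}`. [cite: BravyiKlieschKoenigTang2020, Introduction (X^{⊗n})] -/
theorem conjTranspose_globalFlip : (globalFlip : Matrix (V → Bool) (V → Bool) ℂ)ᴴ = globalFlip :=
  conjTranspose_pauliString _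

/-- `X^{⊗n} σ^z_u X^{⊗n} = −σ^z_u`. [cite: BravyiKlieschKoenigTang2020, proof of Thm. 2 (“V|+^n⟩ and
Z_iV|+^n⟩ are eigenvectors of X^{⊗n} with eigenvalues 1 and −1”)] -/
theorem globalFlip_mul_sitePauli_Z_mul_globalFlip (u : V) :
    globalFlip * sitePauli Pauli.Z u * globalFlip = -sitePauli Pauli.Z u := by
  rw [globalFlip, sitePauli, pauliString_mul_pauliString_mul_pauliString,
    Fintype.prod_eq_single u fun i hi => by rw [siteWord_apply, if_neg hi]; simp [Pauli.sign]]
  rw [siteWord_apply, if_pos rfl]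
  simp [Pauli.sign]

/-- `X^{⊗n} σ^x_u X^{⊗n} = σ^x_u`. [cite: BravyiKlieschKoenigTang2020, Introduction (ℤ₂-symmetric
terms commute with X^{⊗n})] -/
theorem globalFlip_mul_sitePauli_X_mul_globalFlip (u : V) :
    globalFlip * sitePauli Pauli.X u * globalFlip = sitePauli Pauli.X u := by
  rw [globalFlip, sitePauli, pauliString_mul_pauliString_mul_pauliString,
    Fintype.prod_eq_single u fun i hi => by rw [siteWord_apply, if_neg hi]; simp [Pauli.sign]]
  rw [siteWord_apply, if_pos rfl]
  simp [Pauli.sign]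

/-- Plumbing: `P M P = c M` with `P² = 1` gives `P M = c M P`. [folklore] -/
private theorem mul_eq_smul_mul_of_conj {P M : Matrix (V → Bool) (V → Bool) ℂ} {c : ℂ} (hP : P * P = 1)
    (h : P * M * P = c • M) : P * M = c • (M * P) := by
  calc P * M = P * M * (P * P) := by rw [hP, Matrix.mul_one]
    _ = c • M * P := by rw [← Matrix.mul_assoc, h]
    _ = c • (M * P) := by rw [Matrix.smul_mul]

/-- `X^{⊗n} σ^z_a = −σ^z_a X^{⊗n}`. [cite: BravyiKlieschKoenigTang2020, proof of Thm. 2 (Z_iV|+^n⟩ is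
an eigenvector of X^{⊗n} with eigenvalue −1)] -/
theorem globalFlip_mul_sitePauli_Z (a : V) :
    globalFlip * sitePauli Pauli.Z a = -(sitePauli Pauli.Z a * globalFlip) := by
  have h : globalFlip * sitePauli Pauli.Z a * globalFlip = (-1 : ℂ) • sitePauli Pauli.Z a := by
    rw [globalFlip_mul_sitePauli_Z_mul_globalFlip, neg_one_smul]
  rw [mul_eq_smul_mul_of_conj globalFlip_mul_self h, neg_one_smul]

/-- `X^{⊗n} σ^x_a = σ^x_a X^{⊗n}`. [cite: BravyiKlieschKoenigTang2020, Introduction (ℤ₂-symmetric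
terms commute with X^{⊗n})] -/
theorem commute_globalFlip_sitePauli_X (a : V) : Commute globalFlip (sitePauli Pauli.X a) := by
  have h : globalFlip * sitePauli Pauli.X a * globalFlip = (1 : ℂ) • sitePauli Pauli.X a := by
    rw [globalFlip_mul_sitePauli_X_mul_globalFlip, one_smul]
  have h' := mul_eq_smul_mul_of_conj globalFlip_mul_self h
  rw [one_smul] at h'
  exact h'

/-- `X^{⊗n}` commutes with every edge term `½(1 − σ^z_a σ^z_b)` (“`H_n` is ℤ₂-symmetric”). [cite:
BravyiKlieschKoenigTang2020, eq. (H_n = ½ Σ_{(u,v)∈E} (I − Z_u Z_v)) (“Clearly, H_n is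
ℤ₂-symmetric”)] -/
theorem commute_globalFlip_edgeTerm (e : Sym2 V) : Commute globalFlip (edgeTerm e) := by
  induction e using Sym2.ind with
  | h a b =>
    rw [edgeTerm_mk]
    refine ((Commute.one_right _).sub_right ?_).smul_right _
    show globalFlip * (sitePauli Pauli.Z a * sitePauli Pauli.Z b) = sitePauli Pauli.Z a * sitePauli Pauli.Z b * globalFlip
    rw [← Matrix.mul_assoc, globalFlip_mul_sitePauli_Z, Matrix.neg_mul, Matrix.mul_assoc,
      globalFlip_mul_sitePauli_Z, Matrix.mul_neg, neg_neg, Matrix.mul_assoc]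

/-- **`X^{⊗n}` commutes with `U(C, γ)`.** [cite: BravyiKlieschKoenigTang2020, §QAOA (“the QAOA circuit
U(β,γ) with the Hamiltonian H_n … obey[s] the ℤ₂-symmetry property”)] -/
theorem commute_globalFlip_costUnitary (γ : ℝ) : Commute globalFlip (costUnitary G γ) := by
  rw [costUnitary_eq_exp, costOp]
  exact ((Commute.sum_right _ _ _ fun e _ => commute_globalFlip_edgeTerm e).smul_right _).exp_right

/-- **`X^{⊗n}` commutes with `U(B, β)`.** [cite: BravyiKlieschKoenigTang2020, §QAOA (“the QAOA circuit
U(β,γ) … obey[s] the ℤ₂-symmetry property”)] -/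
theorem commute_globalFlip_mixUnitary (β : ℝ) :
    Commute globalFlip (mixUnitary β : Matrix (V → Bool) (V → Bool) ℂ) := by
  rw [mixUnitary_eq_exp, mixOp]
  exact ((Commute.sum_right _ _ _ fun w _ => commute_globalFlip_sitePauli_X w).smul_right _).exp_right

/-- **The level-`p` QAOA circuit is ℤ₂-symmetric: `U X^{⊗n} = X^{⊗n} U`.** [cite:
BravyiKlieschKoenigTang2020, §QAOA (“Crucially, the QAOA circuit U(β,γ) with the Hamiltonian H_n as
well as the initial QAOA state |+^n⟩ obey the ℤ₂-symmetry property”)] -/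
theorem commute_globalFlip_qaoaUnitaryP (p : ℕ) (γ β : Fin p → ℝ) :
    Commute globalFlip (qaoaUnitaryP G p γ β) := by
  induction p with
  | zero => rw [qaoaUnitaryP]; exact Commute.one_right _
  | succ p ih =>
    rw [qaoaUnitaryP]
    exact ((commute_globalFlip_mixUnitary _).mul_right (commute_globalFlip_costUnitary G _)).mul_right (ih _ _)

/-- **`|+^n⟩` is ℤ₂-symmetric: `X^{⊗n} ρ₀ X^{⊗n} = ρ₀`.** [cite: BravyiKlieschKoenigTang2020, §QAOA
(“the initial QAOA state |+^n⟩ obey[s] the ℤ₂-symmetry property”)] -/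
theorem globalFlip_mul_initialState_mul_globalFlip :
    globalFlip * initialState * globalFlip = (initialState : Matrix (V → Bool) (V → Bool) ℂ) := by
  rw [globalFlip, initialState, pauliString_eq, tensorAll_mul, tensorAll_mul]
  congr
  funext i
  rw [Matrix.mul_smul, Matrix.smul_mul, Matrix.mul_add, Matrix.mul_one, Pauli.mat_mul_self,
    Matrix.add_mul, Matrix.one_mul, Pauli.mat_mul_self]

/-- **A ℤ₂-symmetric circuit gives every `σ^z_u` expectation zero:** `tr[σ^z_u · Wρ₀W†] = 0` when
`W X^{⊗n} = X^{⊗n} W` (“`⟨+^n|V†Z_iV|+^n⟩ = 0` for any qubit `i` since `V|+^n⟩` and `Z_iV|+^n⟩`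
are eigenvectors of `X^{⊗n}` with eigenvalues `1` and `−1`”). [cite: BravyiKlieschKoenigTang2020,
proof of Thm. 2] -/
theorem trace_sitePauli_Z_mul_conj_eq_zero {W : Matrix (V → Bool) (V → Bool) ℂ} (hW : Commute globalFlip W)
    (u : V) : (sitePauli Pauli.Z u * (W * initialState * Wᴴ)).trace = 0 := by
  have h1 : globalFlip * W = W * globalFlip := hW.eq
  have h2 : Wᴴ * globalFlip = globalFlip * Wᴴ := by
    have := congr_arg conjTranspose h1
    rwa [conjTranspose_mul, conjTranspose_mul, conjTranspose_globalFlip] at this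
  have hρ : globalFlip * (W * initialState * Wᴴ) * globalFlip = W * initialState * Wᴴ := by
    calc globalFlip * (W * initialState * Wᴴ) * globalFlip
        = (globalFlip * W) * initialState * (Wᴴ * globalFlip) := by simp only [Matrix.mul_assoc]
      _ = (W * globalFlip) * initialState * (globalFlip * Wᴴ) := by rw [h1, h2]
      _ = W * (globalFlip * initialState * globalFlip) * Wᴴ := by simp only [Matrix.mul_assoc]
      _ = W * initialState * Wᴴ := by rw [globalFlip_mul_initialState_mul_globalFlip]
  set ρ := W * initialState * Wᴴ
  have h : (sitePauli Pauli.Z u * ρ).trace = -(sitePauli Pauli.Z u * ρ).trace := by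
    calc (sitePauli Pauli.Z u * ρ).trace = (sitePauli Pauli.Z u * (globalFlip * ρ * globalFlip)).trace := by rw [hρ]
      _ = (sitePauli Pauli.Z u * globalFlip * ρ * globalFlip).trace := by simp only [Matrix.mul_assoc]
      _ = (globalFlip * sitePauli Pauli.Z u * globalFlip * ρ).trace := by
          rw [Matrix.trace_mul_comm]
          simp only [Matrix.mul_assoc]
      _ = -(sitePauli Pauli.Z u * ρ).trace := by
          rw [globalFlip_mul_sitePauli_Z_mul_globalFlip, Matrix.neg_mul, trace_neg]
  rw [eq_neg_iff_add_eq_zero, ← two_mul, mul_eq_zero] at h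
  exact h.resolve_left two_ne_zero

/-- **`⟨γ, β| σ^z_u |γ, β⟩ = 0`** for QAOA-MaxCut at every level. [cite: BravyiKlieschKoenigTang2020,
proof of Thm. 2 (applied to the ℤ₂-symmetric QAOA circuit)] -/
theorem trace_sitePauli_Z_mul_finalStateP (p : ℕ) (γ β : Fin p → ℝ) (u : V) :
    (sitePauli Pauli.Z u * finalStateP G p γ β).trace = 0 :=
  trace_sitePauli_Z_mul_conj_eq_zero (commute_globalFlip_qaoaUnitaryP G p γ β) u

/-! ### States `W|s⟩` and real diagonal expectations -/

/-- The state vector `W|s⟩`. [cite: BravyiKlieschKoenigTang2020, Thm. 2 (the state U|+^n⟩)] -/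
def stateVec (W : Matrix (V → Bool) (V → Bool) ℂ) : (V → Bool) → ℂ := W *ᵥ plusState

/-- `W ρ₀ W† = |W s⟩⟨W s|`. [cite: FarhiGoldstoneGutmann2014, eq. (5) (ρ₀ = |s⟩⟨s|)] -/
theorem conj_initialState_eq_vecMulVec (W : Matrix (V → Bool) (V → Bool) ℂ) :
    W * initialState * Wᴴ = vecMulVec (stateVec W) (star (stateVec W)) := by
  rw [initialState_eq_vecMulVec, stateVec, mul_vecMulVec, vecMulVec_mul, ← star_mulVec]

/-- `⟨W s| D |W s⟩ = Σ_z d(z) |(W s)_z|²` for a real diagonal `D`. [cite: BravyiKlieschKoenigTang2020,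
proof of Thm. 2 (“Suppose one prepares the state V|+^n⟩ and measures a pair of qubits j<k in the
standard basis. Then ε_{j,k} is the probability that the measured values … disagree”)] -/
theorem trace_diagonal_mul_conj (d : (V → Bool) → ℝ) (W : Matrix (V → Bool) (V → Bool) ℂ) :
    (diagonal (fun x => (d x : ℂ)) * (W * initialState * Wᴴ)).trace =
      ((∑ x, d x * ‖stateVec W x‖ ^ 2 : ℝ) : ℂ) := by
  rw [conj_initialState_eq_vecMulVec, mul_vecMulVec, trace_vecMulVec, dotProduct]
  push_cast
  refine Finset.sum_congr rfl fun x _ => ?_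
  rw [mulVec_diagonal, Pi.star_apply, mul_assoc, Complex.star_def, Complex.mul_conj']

/-- **The disagreement probability `ε_{a,b} = ½⟨W s|(1 − σ^z_aσ^z_b)|W s⟩ = P(z_a ≠ z_b)`** as a real
number. [cite: BravyiKlieschKoenigTang2020, proof of Thm. 2 (definition of ε_{j,k})] -/
def disagree (W : Matrix (V → Bool) (V → Bool) ℂ) (a b : V) : ℝ :=
  ∑ z, (cutInd z s(a, b) : ℝ) * ‖stateVec W z‖ ^ 2

/-- `tr[C_{⟨ab⟩} Wρ₀W†] = ε_{a,b}`. [cite: BravyiKlieschKoenigTang2020, proof of Thm. 2 (ε_{j,k} =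
½⟨+^n|V†(I − Z_jZ_k)V|+^n⟩)] -/
theorem trace_edgeTerm_mul_conj (W : Matrix (V → Bool) (V → Bool) ℂ) (a b : V) :
    (edgeTerm s(a, b) * (W * initialState * Wᴴ)).trace = (disagree W a b : ℂ) := by
  rw [edgeTerm_eq_diagonal]
  have : (diagonal fun x => (cutInd x s(a, b) : ℂ)) = diagonal fun x => ((cutInd x s(a, b) : ℝ) : ℂ) := by
    simp only [Complex.ofReal_natCast]
  rw [this, trace_diagonal_mul_conj]
  rfl

omit [Fintype V] [DecidableEq V] in
/-- Disagreement is a pseudo-metric on bits: `[z_a ≠ z_c] ≤ [z_a ≠ z_b] + [z_b ≠ z_c]`. [folklore] -/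
private theorem cutInd_triangle (z : V → Bool) (a b c : V) :
    cutInd z s(a, c) ≤ cutInd z s(a, b) + cutInd z s(b, c) := by
  simp only [cutInd_mk]
  cases z a <;> cases z b <;> cases z c <;> simp

end Symmetry

section RingObstruction

/-! ## Symmetry protection on the ring of disagrees (Bravyi–Kliesch–Koenig–Tang 2020, Theorem 2)

BKKT Theorem 2: “Let `H_n = ½ Σ_{p∈ℤ_n} (I − Z_pZ_{p+1})` be the ring of disagrees Hamiltonian,
where `n` is even. Let `U` be a ℤ₂-symmetric unitary with range `R < n/4`. Then
`(1/n)⟨+^n|U†H_nU|+^n⟩ ≤ (2R + 1/2)/(2R + 1)`. This bound is tight whenever `n` is a multiple of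
`2R + 1`.” Here “`U` has range `R` if the operator `U†Z_jU` has support on the interval `[j−R, j+R]`
for any qubit `j`. For example, the level-`p` QAOA circuit associated with the ring of disagrees has
range `R = p`.” We prove the upper bound, following the printed proof: `X̄ = (XI)^{⊗n/2}` satisfies
`X̄H_nX̄ + H_n = nI`; `V = X̄U` is ℤ₂-symmetric with range `R`; `ε_{j,k} = ½` for `dist(j,k) > 2R`
(the two evolved `Z`'s have disjoint support and each has mean zero by the symmetry); the union bound
`ε_{j,k} ≤ Σ_{i=j}^{k−1} ε_{i,i+1}`; averaging over `j` with `k = j + 2R + 1` gives `½ ≤ ((2R+1)/n)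
⟨+^n|V†H_nV|+^n⟩`. The tightness construction (Appendix B) is not formalised. -/

variable {n : ℕ} [NeZero n]

/-- **The ring of disagrees Hamiltonian `H_n = ½ Σ_{i∈ℤ_n} (I − Z_i Z_{i+1})`** on `n` qubits indexed
by `ℤ_n`. [cite: BravyiKlieschKoenigTang2020, Thm. 2 (H_n)] [cite: FarhiGoldstoneGutmann2014, §4 (the
ring of disagrees)] -/
def ringHam (n : ℕ) [NeZero n] : Matrix (ZMod n → Bool) (ZMod n → Bool) ℂ :=
  ∑ i : ZMod n, edgeTerm s(i, i + 1)

/-- **`⟨W s| H_n |W s⟩ = Σ_i ε_{i,i+1}`** as a real number. [cite: BravyiKlieschKoenigTang2020, proof of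
Thm. 2 (Σ_{i∈ℤ_n} ε_{i,i+1} = ⟨+^n|V†H_nV|+^n⟩)] -/
def ringEnergy (W : Matrix (ZMod n → Bool) (ZMod n → Bool) ℂ) : ℝ := ∑ i : ZMod n, disagree W i (i + 1)

/-- `tr[H_n Wρ₀W†] = Σ_i ε_{i,i+1}`. [cite: BravyiKlieschKoenigTang2020, proof of Thm. 2 (Σ_{i∈ℤ_n}
ε_{i,i+1} = ⟨+^n|V†H_nV|+^n⟩)] -/
theorem trace_ringHam_mul_conj (W : Matrix (ZMod n → Bool) (ZMod n → Bool) ℂ) :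
    (ringHam n * (W * initialState * Wᴴ)).trace = (ringEnergy W : ℂ) := by
  rw [ringHam, ringEnergy, Finset.sum_mul, trace_sum]
  push_cast
  exact Finset.sum_congr rfl fun i _ => trace_edgeTerm_mul_conj W i (i + 1)

/-- **The interval `[j − R, j + R] ⊂ ℤ_n`.** [cite: BravyiKlieschKoenigTang2020, Thm. 2 (“U†Z_jU has
support on the interval [j−R, j+R]”)] -/
def interval (R : ℕ) (j : ZMod n) : Finset (ZMod n) :=
  (Finset.range (2 * R + 1)).image fun a : ℕ => j - R + a

/-- **`W` has range `R`:** every `W†Z_jW` involves only the qubits in `[j − R, j + R]`. [cite: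
BravyiKlieschKoenigTang2020, Thm. 2 (“a unitary U … has range R if the operator U†Z_jU has support
on the interval [j−R, j+R] for any qubit j”)] -/
def HasRange (R : ℕ) (W : Matrix (ZMod n → Bool) (ZMod n → Bool) ℂ) : Prop :=
  ∀ j : ZMod n, ActsWithin (interval R j) (Wᴴ * sitePauli Pauli.Z j * W)

omit [NeZero n] in
/-- `j ∈ [j − R, j + R]`. [folklore] -/
private theorem mem_interval_self (R : ℕ) (j : ZMod n) : j ∈ interval R j :=
  Finset.mem_image.2 ⟨R, Finset.mem_range.2 (by omega), by simp⟩

omit [NeZero n] in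
/-- For `n ≥ 4R + 2` the intervals around `j` and `j + 2R + 1` are disjoint (“`dist(j,k) > 2R` …
`V†Z_jV` and `V†Z_kV` have disjoint support”). [cite: BravyiKlieschKoenigTang2020, proof of Thm. 2] -/
theorem disjoint_interval {R : ℕ} (hR : 4 * R + 2 ≤ n) (j : ZMod n) :
    Disjoint (interval R j) (interval R (j + (2 * R + 1 : ℕ))) := by
  rw [Finset.disjoint_left]
  rintro x hx hx'
  rw [interval, Finset.mem_image] at hx hx'
  obtain ⟨a, ha, rfl⟩ := hx
  obtain ⟨b, hb, hab⟩ := hx'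
  rw [Finset.mem_range] at ha hb
  have h : ((2 * R + 1 + b : ℕ) : ZMod n) = (a : ZMod n) := by
    push_cast at hab ⊢
    linear_combination hab
  rw [ZMod.natCast_eq_natCast_iff', Nat.mod_eq_of_lt (by omega), Nat.mod_eq_of_lt (by omega)] at h
  omega

/-- **Far-apart `Z`'s are uncorrelated for a symmetric range-`R` circuit:**
`⟨+^n|V†Z_jZ_kV|+^n⟩ = ⟨+^n|V†Z_jV|+^n⟩·⟨+^n|V†Z_kV|+^n⟩ = 0` for `k = j + 2R + 1`, `n ≥ 4R + 2`.
[cite: BravyiKlieschKoenigTang2020, proof of Thm. 2 (display after “Thus”)] -/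
theorem trace_ZZ_mul_conj_eq_zero {R : ℕ} (hR : 4 * R + 2 ≤ n) {W : Matrix (ZMod n → Bool) (ZMod n → Bool) ℂ}
    (hWu : Wᴴ * W = 1) (hsym : Commute globalFlip W) (hrange : HasRange R W) (j : ZMod n) :
    (sitePauli Pauli.Z j * sitePauli Pauli.Z (j + (2 * R + 1 : ℕ)) * (W * initialState * Wᴴ)).trace = 0 := by
  have hWu' : W * Wᴴ = 1 := mul_eq_one_comm.1 hWu
  have cyc : ∀ O : Matrix (ZMod n → Bool) (ZMod n → Bool) ℂ,
      (O * (W * initialState * Wᴴ)).trace = (Wᴴ * O * W * initialState).trace := fun O => by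
    rw [← Matrix.mul_assoc, ← Matrix.mul_assoc, Matrix.trace_mul_comm, ← Matrix.mul_assoc,
      ← Matrix.mul_assoc]
  set k := j + (2 * R + 1 : ℕ)
  have key : Wᴴ * (sitePauli Pauli.Z j * sitePauli Pauli.Z k) * W =
      (Wᴴ * sitePauli Pauli.Z j * W) * (Wᴴ * sitePauli Pauli.Z k * W) := by
    simp only [Matrix.mul_assoc]
    rw [← Matrix.mul_assoc W Wᴴ, hWu', Matrix.one_mul]
  rw [cyc, key, trace_mul_mul_initialState (disjoint_interval hR j) (hrange j) (hrange k), ← cyc,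
    trace_sitePauli_Z_mul_conj_eq_zero hsym, zero_mul]

/-- `tr[Wρ₀W†] = 1` for `W†W = 1`. [folklore] -/
private theorem trace_conj_initialState {W : Matrix (V → Bool) (V → Bool) ℂ} (hWu : Wᴴ * W = 1) :
    (W * initialState * Wᴴ).trace = 1 := by
  rw [Matrix.trace_mul_cycle, hWu, Matrix.one_mul, trace_initialState]

/-- **`ε_{j,k} = ½` for `k = j + 2R + 1`** (`n ≥ 4R + 2`, `W` ℤ₂-symmetric of range `R`). [cite:
BravyiKlieschKoenigTang2020, proof of Thm. 2 (eq. “ε_{j,k} = ½ if dist(j,k) > 2R”)] -/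
theorem disagree_far {R : ℕ} (hR : 4 * R + 2 ≤ n) {W : Matrix (ZMod n → Bool) (ZMod n → Bool) ℂ}
    (hWu : Wᴴ * W = 1) (hsym : Commute globalFlip W) (hrange : HasRange R W) (j : ZMod n) :
    disagree W j (j + (2 * R + 1 : ℕ)) = 1 / 2 := by
  have h := trace_edgeTerm_mul_conj W j (j + (2 * R + 1 : ℕ))
  rw [edgeTerm_mk, Matrix.smul_mul, Matrix.sub_mul, Matrix.one_mul, trace_smul, trace_sub,
    trace_conj_initialState hWu, trace_ZZ_mul_conj_eq_zero hR hWu hsym hrange j, sub_zero, smul_eq_mul,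
    mul_one] at h
  have h' : ((disagree W j (j + (2 * R + 1 : ℕ)) : ℝ) : ℂ) = ((1 / 2 : ℝ) : ℂ) := by
    rw [← h]
    push_cast
    rfl
  exact Complex.ofReal_injective h'

/-- **Union bound along a path: `ε_{j,j+m} ≤ Σ_{t<m} ε_{j+t,j+t+1}`** (“if qubits j and k disagree, at
least one pair of consecutive qubits located in the interval [j,k] must disagree”). [cite:
BravyiKlieschKoenigTang2020, proof of Thm. 2 (“By the union bound, ε_{j,k} ≤ Σ_{i=j}^{k−1}
ε_{i,i+1}”)] -/
theorem disagree_le_sum (W : Matrix (ZMod n → Bool) (ZMod n → Bool) ℂ) (j : ZMod n) (m : ℕ) :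
    disagree W j (j + m) ≤ ∑ t ∈ Finset.range m, disagree W (j + t) (j + t + 1) := by
  have hpt : ∀ z : ZMod n → Bool, (cutInd z s(j, j + m) : ℝ) ≤
      ∑ t ∈ Finset.range m, (cutInd z s(j + t, j + t + 1) : ℝ) := by
    intro z
    induction m with
    | zero => simp
    | succ m ih =>
      rw [Finset.sum_range_succ]
      have h := cutInd_triangle z j (j + m) (j + (m + 1 : ℕ))
      have h' : (cutInd z s(j, j + (m + 1 : ℕ)) : ℝ) ≤ cutInd z s(j, j + m) + cutInd z s(j + m, j + (m + 1 : ℕ)) := by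
        exact_mod_cast h
      have e : (j + ((m + 1 : ℕ) : ZMod n)) = j + m + 1 := by push_cast; ring
      rw [e] at h' ⊢
      linarith
  unfold disagree
  rw [Finset.sum_comm]
  refine Finset.sum_le_sum fun z _ => ?_
  rw [← Finset.sum_mul]
  exact mul_le_mul_of_nonneg_right (hpt z) (sq_nonneg _)

/-- **Averaging the union bound over the ring:** `Σ_j ε_{j,j+m} ≤ m · Σ_i ε_{i,i+1}` (“Take the
expected value … with respect to random uniform j ∈ ℤ_n”). [cite: BravyiKlieschKoenigTang2020, proof
of Thm. 2 (display “½ ≤ (2R+1)/n Σ_{i∈ℤ_n} ε_{i,i+1}”)] -/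
theorem sum_disagree_le (W : Matrix (ZMod n → Bool) (ZMod n → Bool) ℂ) (m : ℕ) :
    ∑ j : ZMod n, disagree W j (j + m) ≤ m * ringEnergy W := by
  calc ∑ j : ZMod n, disagree W j (j + m)
      ≤ ∑ j : ZMod n, ∑ t ∈ Finset.range m, disagree W (j + t) (j + t + 1) :=
        Finset.sum_le_sum fun j _ => disagree_le_sum W j m
    _ = ∑ t ∈ Finset.range m, ∑ j : ZMod n, disagree W (j + t) (j + t + 1) := Finset.sum_comm
    _ = ∑ t ∈ Finset.range m, ringEnergy W := by
        refine Finset.sum_congr rfl fun t _ => ?_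
        rw [ringEnergy]
        exact Fintype.sum_equiv (Equiv.addRight (t : ZMod n)) _ _ fun j => rfl
    _ = m * ringEnergy W := by rw [Finset.sum_const, Finset.card_range, nsmul_eq_mul]

/-- **The symmetric-circuit lower bound (BKKT eq. “cycle3”):** `n/2 ≤ (2R+1) ⟨+^n|V†H_nV|+^n⟩` for
every ℤ₂-symmetric `V` of range `R`, `n ≥ 4R + 2`. [cite: BravyiKlieschKoenigTang2020, proof of Thm. 2
(“(1/n)⟨+^n|V†H_nV|+^n⟩ ≥ 1/(2(2R+1))”)] -/
theorem ringEnergy_ge {R : ℕ} (hR : 4 * R + 2 ≤ n) {W : Matrix (ZMod n → Bool) (ZMod n → Bool) ℂ}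
    (hWu : Wᴴ * W = 1) (hsym : Commute globalFlip W) (hrange : HasRange R W) :
    (n : ℝ) / 2 ≤ (2 * R + 1 : ℕ) * ringEnergy W := by
  have h := sum_disagree_le W (2 * R + 1)
  have h2 : ∑ j : ZMod n, disagree W j (j + (2 * R + 1 : ℕ)) = (n : ℝ) / 2 := by
    rw [Finset.sum_congr rfl fun j _ => disagree_far hR hWu hsym hrange j, Finset.sum_const,
      Finset.card_univ, ZMod.card, nsmul_eq_mul]
    ring
  rw [h2] at h
  exact h

/-! ### The staggered flip `X̄ = (XI)^{⊗n/2}` -/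

/-- The letters of `X̄ = (XI)^{⊗n/2}`: `X` on the even sites of `ℤ_n`. [cite: BravyiKlieschKoenigTang2020,
proof of Thm. 2 (“Define X̄ = (XI)^{⊗n/2}”)] -/
def altWord (n : ℕ) [NeZero n] : ZMod n → Pauli := fun i => if Even (ZMod.val i) then Pauli.X else Pauli.I

/-- **`X̄ = (XI)^{⊗n/2}`.** [cite: BravyiKlieschKoenigTang2020, proof of Thm. 2 (“Define X̄ = (XI)^{⊗n/2}”)] -/
def altFlip (n : ℕ) [NeZero n] : Matrix (ZMod n → Bool) (ZMod n → Bool) ℂ := pauliString (altWord n)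

/-- The sign `X̄ Z_i X̄ = s_i Z_i`: `−1` on even sites, `+1` on odd sites. [folklore] -/
def altSign (i : ZMod n) : ℂ := if Even (ZMod.val i) then -1 else 1

/-- On an even ring consecutive sites have opposite parity. [folklore] -/
private theorem even_val_add_one (hn : Even n) (h2 : 2 ≤ n) (i : ZMod n) :
    Even (ZMod.val (i + 1)) ↔ ¬ Even (ZMod.val i) := by
  rw [ZMod.val_add, ZMod.val_one_eq_one_mod, Nat.mod_eq_of_lt (show 1 < n by omega)]
  have hi := ZMod.val_lt i
  by_cases h : ZMod.val i + 1 < n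
  · rw [Nat.mod_eq_of_lt h, Nat.even_add_one]
  · have he : ZMod.val i + 1 = n := by omega
    rw [he, Nat.mod_self]
    have : Even (ZMod.val i + 1) := by rw [he]; exact hn
    rw [Nat.even_add_one] at this
    simpa using this

/-- `s_i s_{i+1} = −1` on an even ring. [cite: BravyiKlieschKoenigTang2020, proof of Thm. 2 (X̄H_nX̄ +
H_n = nI)] -/
private theorem altSign_mul_altSign_add_one (hn : Even n) (h2 : 2 ≤ n) (i : ZMod n) :
    altSign i * altSign (i + 1) = -1 := by
  have h := even_val_add_one hn h2 i
  unfold altSign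
  by_cases hi : Even (ZMod.val i)
  · rw [if_pos hi, if_neg (fun h' => (h.1 h') hi)]; norm_num
  · rw [if_neg hi, if_pos (h.2 hi)]; norm_num

/-- `X̄ X̄ = 1`. [folklore] -/
private theorem altFlip_mul_self : altFlip n * altFlip n = 1 := pauliString_mul_self _

/-- `X̄† = X̄`. [folklore] -/
private theorem conjTranspose_altFlip : (altFlip n)ᴴ = altFlip n := conjTranspose_pauliString _

/-- `X̄ Z_i X̄ = s_i Z_i`. [cite: BravyiKlieschKoenigTang2020, proof of Thm. 2 (X̄H_nX̄ + H_n = nI)] -/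
theorem altFlip_mul_sitePauli_Z_mul_altFlip (i : ZMod n) :
    altFlip n * sitePauli Pauli.Z i * altFlip n = altSign i • sitePauli Pauli.Z i := by
  rw [altFlip, sitePauli, pauliString_mul_pauliString_mul_pauliString,
    Fintype.prod_eq_single i fun w hw => by rw [siteWord_apply, if_neg hw]; simp [Pauli.sign]]
  rw [siteWord_apply, if_pos rfl, altWord, altSign]
  by_cases h : Even (ZMod.val i)
  · simp [h, Pauli.sign]
  · simp [h, Pauli.sign]

/-- **`X̄ C_{⟨i,i+1⟩} X̄ = 1 − C_{⟨i,i+1⟩}` on an even ring** (exactly one endpoint is flipped).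
[cite: BravyiKlieschKoenigTang2020, proof of Thm. 2 (X̄H_nX̄ + H_n = nI)] -/
theorem altFlip_mul_edgeTerm_mul_altFlip (hn : Even n) (h2 : 2 ≤ n) (i : ZMod n) :
    altFlip n * edgeTerm s(i, i + 1) * altFlip n = 1 - edgeTerm s(i, i + 1) := by
  have hZZ : altFlip n * (sitePauli Pauli.Z i * sitePauli Pauli.Z (i + 1)) * altFlip n =
      -(sitePauli Pauli.Z i * sitePauli Pauli.Z (i + 1)) := by
    calc altFlip n * (sitePauli Pauli.Z i * sitePauli Pauli.Z (i + 1)) * altFlip n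
        = (altFlip n * sitePauli Pauli.Z i * altFlip n) * (altFlip n * sitePauli Pauli.Z (i + 1) * altFlip n) := by
          simp only [Matrix.mul_assoc]
          rw [← Matrix.mul_assoc (altFlip n) (altFlip n) (sitePauli Pauli.Z (i + 1) * altFlip n),
            altFlip_mul_self, Matrix.one_mul]
      _ = -(sitePauli Pauli.Z i * sitePauli Pauli.Z (i + 1)) := by
          rw [altFlip_mul_sitePauli_Z_mul_altFlip, altFlip_mul_sitePauli_Z_mul_altFlip, Matrix.smul_mul,
            Matrix.mul_smul, smul_smul, altSign_mul_altSign_add_one hn h2, neg_one_smul]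
  rw [edgeTerm_mk, Matrix.mul_smul, Matrix.smul_mul, Matrix.mul_sub, Matrix.sub_mul, Matrix.mul_one,
    altFlip_mul_self, hZZ, sub_neg_eq_add]
  ext x y
  simp only [Matrix.smul_apply, Matrix.add_apply, Matrix.sub_apply, smul_eq_mul]
  ring

/-- **BKKT eq. “cycle2”: `X̄ H_n X̄ + H_n = n I`** (`n` even). [cite: BravyiKlieschKoenigTang2020, proof
of Thm. 2 (“X H_n X + H_n = nI”)] -/
theorem altFlip_mul_ringHam_mul_altFlip_add (hn : Even n) (h2 : 2 ≤ n) :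
    altFlip n * ringHam n * altFlip n + ringHam n = (n : ℂ) • (1 : Matrix (ZMod n → Bool) (ZMod n → Bool) ℂ) := by
  rw [ringHam, Finset.mul_sum, Finset.sum_mul]
  simp_rw [altFlip_mul_edgeTerm_mul_altFlip hn h2]
  rw [← Finset.sum_add_distrib]
  simp_rw [sub_add_cancel]
  rw [Finset.sum_const, Finset.card_univ, ZMod.card, ← Nat.cast_smul_eq_nsmul ℂ]

/-- `X^{⊗n}` commutes with `X̄`. [folklore] -/
private theorem commute_globalFlip_altFlip : Commute globalFlip (altFlip n) := by
  have hp : (∏ i : ZMod n, Pauli.sign Pauli.X (altWord n i)) = 1 :=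
    Finset.prod_eq_one fun i _ => by unfold altWord; split_ifs <;> simp [Pauli.sign]
  have h : globalFlip * altFlip n * globalFlip = (1 : ℂ) • altFlip n := by
    unfold globalFlip altFlip
    rw [pauliString_mul_pauliString_mul_pauliString, hp]
  have h' := mul_eq_smul_mul_of_conj globalFlip_mul_self h
  rw [one_smul] at h'
  exact h'

/-- **`V = X̄U` is again ℤ₂-symmetric, unitary, and of range `R`.** [cite: BravyiKlieschKoenigTang2020,
proof of Thm. 2 (“Let V = X̄U. Note that V is a ℤ₂ symmetric circuit with range R”)] -/
theorem hasRange_altFlip_mul {R : ℕ} {U : Matrix (ZMod n → Bool) (ZMod n → Bool) ℂ} (hrange : HasRange R U) :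
    HasRange R (altFlip n * U) := by
  intro j
  rw [conjTranspose_mul, conjTranspose_altFlip]
  have : Uᴴ * altFlip n * sitePauli Pauli.Z j * (altFlip n * U) = altSign j • (Uᴴ * sitePauli Pauli.Z j * U) := by
    calc Uᴴ * altFlip n * sitePauli Pauli.Z j * (altFlip n * U)
        = Uᴴ * (altFlip n * sitePauli Pauli.Z j * altFlip n) * U := by simp only [Matrix.mul_assoc]
      _ = altSign j • (Uᴴ * sitePauli Pauli.Z j * U) := by
          rw [altFlip_mul_sitePauli_Z_mul_altFlip, Matrix.mul_smul, Matrix.smul_mul]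
  rw [this]
  exact (hrange j).smul _

/-! ### Theorem 2 (upper bound) -/

/-- **Theorem 2 of Bravyi–Kliesch–Koenig–Tang (upper bound), in absolute form:** for even `n`, every
ℤ₂-symmetric unitary `U` of range `R < n/4` has `⟨+^n|U†H_nU|+^n⟩ ≤ n (2R + ½)/(2R + 1)` on the ring
of disagrees. [cite: BravyiKlieschKoenigTang2020, Thm. 2] -/
theorem ringEnergy_le (hn : Even n) {R : ℕ} (hR : 4 * R < n) {U : Matrix (ZMod n → Bool) (ZMod n → Bool) ℂ}
    (hU : Uᴴ * U = 1) (hsym : Commute globalFlip U) (hrange : HasRange R U) :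
    ringEnergy U ≤ n * ((2 * R + 1 / 2) / (2 * R + 1)) := by
  have hR2 : 4 * R + 2 ≤ n := by
    obtain ⟨k, hk⟩ := hn
    omega
  have h2 : 2 ≤ n := by omega
  -- the flipped circuit V = X̄ U
  set V := altFlip n * U with hV
  have hVu : Vᴴ * V = 1 := by
    rw [hV, conjTranspose_mul, conjTranspose_altFlip, Matrix.mul_assoc, ← Matrix.mul_assoc (altFlip n),
      altFlip_mul_self, Matrix.one_mul, hU]
  have hVsym : Commute globalFlip V := commute_globalFlip_altFlip.mul_right hsym
  have hVrange : HasRange R V := hasRange_altFlip_mul hrange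
  have hlow := ringEnergy_ge hR2 hVu hVsym hVrange
  -- E_U + E_V = n
  have hsum : ringEnergy U + ringEnergy V = n := by
    have hc : ((ringEnergy V : ℝ) : ℂ) = (altFlip n * ringHam n * altFlip n * (U * initialState * Uᴴ)).trace := by
      rw [← trace_ringHam_mul_conj, hV, conjTranspose_mul, conjTranspose_altFlip]
      rw [show ringHam n * (altFlip n * U * initialState * (Uᴴ * altFlip n)) =
          (ringHam n * altFlip n) * (U * initialState * Uᴴ * altFlip n) by simp only [Matrix.mul_assoc],
        Matrix.trace_mul_comm, Matrix.trace_mul_comm (altFlip n * ringHam n * altFlip n)]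
      simp only [Matrix.mul_assoc]
    have htot : (ringEnergy U : ℂ) + ringEnergy V = n := by
      rw [hc, ← trace_ringHam_mul_conj, ← trace_add, ← Matrix.add_mul, add_comm,
        altFlip_mul_ringHam_mul_altFlip_add hn h2, Matrix.smul_mul, Matrix.one_mul, trace_smul,
        trace_conj_initialState hU, smul_eq_mul, mul_one]
    exact_mod_cast htot
  -- combine
  have hpos : (0 : ℝ) < 2 * R + 1 := by positivity
  rw [mul_div_assoc', le_div_iff₀ hpos]
  have hlow' : (n : ℝ) / 2 ≤ (2 * R + 1) * ringEnergy V := by exact_mod_cast hlow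
  have hE : ringEnergy U = n - ringEnergy V := by linarith
  rw [hE]
  linear_combination hlow'

/-- **Theorem 2 of Bravyi–Kliesch–Koenig–Tang (upper bound), as printed:**
`(1/n) ⟨+^n|U†H_nU|+^n⟩ ≤ (2R + ½)/(2R + 1)`. [cite: BravyiKlieschKoenigTang2020, Thm. 2] -/
theorem ringEnergy_div_le (hn : Even n) {R : ℕ} (hR : 4 * R < n) {U : Matrix (ZMod n → Bool) (ZMod n → Bool) ℂ}
    (hU : Uᴴ * U = 1) (hsym : Commute globalFlip U) (hrange : HasRange R U) :
    ringEnergy U / n ≤ (2 * R + 1 / 2) / (2 * R + 1) := by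
  have hn0 : (0 : ℝ) < n := by exact_mod_cast Nat.pos_of_ne_zero (NeZero.ne n)
  rw [div_le_iff₀ hn0, mul_comm]
  exact ringEnergy_le hn hR hU hsym hrange

/-! ### The QAOA circuit of the ring has range `p` -/

/-- **The ring (cycle graph) on `ℤ_n`** — FGG's “Regular of degree 2 (and connected) means that the
graph is a ring”, BKKT's “MaxCut problem on the cycle graph ℤ_n”. [cite: FarhiGoldstoneGutmann2014, §4]
[cite: BravyiKlieschKoenigTang2020, §QAOA (the ring of disagrees)] -/
def ringGraph (n : ℕ) [NeZero n] : SimpleGraph (ZMod n) where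
  Adj i j := i ≠ j ∧ (j = i + 1 ∨ i = j + 1)
  symm := ⟨fun _ _ h => ⟨h.1.symm, h.2.symm⟩⟩
  loopless := ⟨fun _ h => h.1 rfl⟩

/-- Adjacency on the ring is decidable. [folklore] -/
instance ringGraphDecidableRel : DecidableRel (ringGraph n).Adj := by
  intro a b; unfold ringGraph; infer_instance

omit [NeZero n] in
/-- `1 ≠ 0` in `ℤ_n` for `n ≥ 2`. [folklore] -/
private theorem one_ne_zero_zmod (h2 : 2 ≤ n) : (1 : ZMod n) ≠ 0 := by
  intro h
  have := congr_arg ZMod.val h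
  rw [ZMod.val_one_eq_one_mod, ZMod.val_zero, Nat.mod_eq_of_lt (show 1 < n by omega)] at this
  exact one_ne_zero this

omit [NeZero n] in
/-- `2 ≠ 0` in `ℤ_n` for `n ≥ 3`. [folklore] -/
private theorem two_ne_zero_zmod (h3 : 3 ≤ n) : (2 : ZMod n) ≠ 0 := by
  intro h
  have h' : ((2 : ℕ) : ZMod n) = 0 := by exact_mod_cast h
  rw [ZMod.natCast_eq_zero_iff] at h'
  have := Nat.le_of_dvd (by norm_num) h'
  omega

/-- `i ~ i + 1` on the ring (`n ≥ 2`). [folklore] -/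
private theorem ringGraph_adj_add_one (h2 : 2 ≤ n) (i : ZMod n) : (ringGraph n).Adj i (i + 1) := by
  refine ⟨fun h => one_ne_zero_zmod h2 ?_, Or.inl rfl⟩
  have := congr_arg (fun x => x - i) h
  simpa using this.symm

/-- The edges of the ring are the `⟨i, i+1⟩` (`n ≥ 2`). [cite: BravyiKlieschKoenigTang2020, Thm. 2
(H_n = ½ Σ_{p∈ℤ_n} (I − Z_pZ_{p+1}))] -/
private theorem edgeFinset_ringGraph (h2 : 2 ≤ n) :
    (ringGraph n).edgeFinset = Finset.univ.image fun i : ZMod n => s(i, i + 1) := by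
  ext e
  rw [SimpleGraph.mem_edgeFinset, Finset.mem_image]
  induction e using Sym2.ind with
  | h a b =>
    rw [SimpleGraph.mem_edgeSet]
    constructor
    · rintro ⟨-, h | h⟩
      · exact ⟨a, Finset.mem_univ _, by rw [h]⟩
      · exact ⟨b, Finset.mem_univ _, by rw [h, Sym2.eq_swap]⟩
    · rintro ⟨i, -, hi⟩
      rw [Sym2.eq_iff] at hi
      rcases hi with ⟨rfl, rfl⟩ | ⟨rfl, rfl⟩
      · exact ringGraph_adj_add_one h2 i
      · exact (ringGraph_adj_add_one h2 i).symm

/-- **The MaxCut Hamiltonian of the ring graph is `H_n`** (`n ≥ 3`). [cite: BravyiKlieschKoenigTang2020,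
Thm. 2 (H_n)] [cite: FarhiGoldstoneGutmann2014, §4 (eq. (12) on the ring)] -/
theorem costOp_ringGraph (h3 : 3 ≤ n) : costOp (ringGraph n) = ringHam n := by
  rw [costOp, edgeFinset_ringGraph (by omega), Finset.sum_image, ringHam]
  intro i _ j _ hij
  rw [Sym2.eq_iff] at hij
  rcases hij with ⟨h, -⟩ | ⟨h1, h2⟩
  · exact h
  · exfalso
    exact two_ne_zero_zmod h3 (by linear_combination h2 - h1)

/-- `N([j − r, j + r]) ⊆ [j − (r+1), j + (r+1)]` on the ring. [folklore] -/
private theorem nbhd_interval_subset (r : ℕ) (j : ZMod n) :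
    nbhd (ringGraph n) (interval r j) ⊆ interval (r + 1) j := by
  intro x hx
  rw [mem_nbhd_iff] at hx
  rw [interval, Finset.mem_image]
  rcases hx with hx | ⟨a, ha, hax⟩
  · rw [interval, Finset.mem_image] at hx
    obtain ⟨t, ht, rfl⟩ := hx
    rw [Finset.mem_range] at ht
    exact ⟨t + 1, Finset.mem_range.2 (by omega), by push_cast; ring⟩
  · rw [interval, Finset.mem_image] at ha
    obtain ⟨t, ht, rfl⟩ := ha
    rw [Finset.mem_range] at ht
    rcases hax.2 with h | h
    · exact ⟨t + 2, Finset.mem_range.2 (by omega), by rw [h]; push_cast; ring⟩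
    · refine ⟨t, Finset.mem_range.2 (by omega), ?_⟩
      push_cast at h ⊢
      linear_combination h

/-- **On the ring, the qubits within distance `k` of `j` lie in `[j − k, j + k]`.** [cite:
BravyiKlieschKoenigTang2020, Thm. 2 (“the level-p QAOA circuit associated with the ring of disagrees
has range R = p”)] -/
theorem ball_ringGraph_subset_interval (k : ℕ) (j : ZMod n) : ball (ringGraph n) k {j} ⊆ interval k j := by
  induction k with
  | zero =>
    rw [ball_zero, Finset.singleton_subset_iff]
    exact mem_interval_self 0 j
  | succ k ih => rw [ball_succ']; exact (nbhd_mono _ ih).trans (nbhd_interval_subset k j)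

/-- **The level-`p` QAOA circuit of the ring has range `p`.** [cite: BravyiKlieschKoenigTang2020, Thm. 2
(“For example, the level-p QAOA circuit associated with the ring of disagrees has range R = p”)] -/
theorem hasRange_qaoaUnitaryP (p : ℕ) (γ β : Fin p → ℝ) : HasRange p (qaoaUnitaryP (ringGraph n) p γ β) :=
  fun j => ((lightCone (ringGraph n) p {j} (ball (ringGraph n) p {j}) (sitePauli Pauli.Z j)
    (actsWithin_sitePauli (Finset.mem_singleton_self j) Pauli.Z)
    (fun _ hk => ball_mono _ (le_of_lt hk) _) γ β).1).mono (ball_ringGraph_subset_interval p j)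

/-- `F_p` on the ring is the ring energy of the QAOA circuit. [cite: BravyiKlieschKoenigTang2020, Thm. 2
(⟨+^n|U†H_nU|+^n⟩ for the QAOA circuit U)] [cite: FarhiGoldstoneGutmann2014, eq. (7)] -/
theorem meanCut_ringGraph (h3 : 3 ≤ n) (p : ℕ) (γ β : Fin p → ℝ) :
    meanCut (ringGraph n) p γ β = ringEnergy (qaoaUnitaryP (ringGraph n) p γ β) := by
  have h := levelP_eq_meanCut (ringGraph n) p γ β
  rw [levelP, costOp_ringGraph h3, finalStateP, trace_ringHam_mul_conj] at h
  exact_mod_cast h.symm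

/-- **Corollary for QAOA (BKKT Theorem 2 with `R = p`): on the ring of disagrees with `n` even and
`p < n/4`, `F_p(γ, β) ≤ n (2p + ½)/(2p + 1)` for all angles.** [cite: BravyiKlieschKoenigTang2020,
Thm. 2 and §QAOA (“the level-p QAOA circuit associated with the ring of disagrees has range R = p”)] -/
theorem meanCut_ringGraph_le (hn : Even n) {p : ℕ} (hp : 0 < p) (hpn : 4 * p < n) (γ β : Fin p → ℝ) :
    meanCut (ringGraph n) p γ β ≤ n * ((2 * p + 1 / 2) / (2 * p + 1)) := by
  rw [meanCut_ringGraph (by omega)]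
  exact ringEnergy_le hn hpn (qaoaUnitaryP_conjTranspose_mul_self _ p γ β)
    (commute_globalFlip_qaoaUnitaryP _ p γ β) (hasRange_qaoaUnitaryP p γ β)

/-- **`M_p ≤ n (2p + ½)/(2p + 1)` on the even ring with `n > 4p`:** the level-`p` QAOA approximation
ratio for the ring of disagrees (maximum cut `n`) is at most `(2p + ½)/(2p + 1)`. [cite:
BravyiKlieschKoenigTang2020, Thm. 2 (“rigorously establishing” the bound conjectured tight at
(2p+1)/(2p+2) by [mbengfaziosantoro2019] for QAOA)] [cite: FarhiGoldstoneGutmann2014, §4 (ring of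
disagrees: 3/4, 5/6, … for p = 1, 2, …)] -/
theorem maxLevel_ringGraph_le (hn : Even n) {p : ℕ} (hp : 0 < p) (hpn : 4 * p < n) :
    maxLevel (ringGraph n) p ≤ n * ((2 * p + 1 / 2) / (2 * p + 1)) :=
  ciSup_le fun a => meanCut_ringGraph_le hn hp hpn a.1 a.2


/-! ### Level 1 on the ring: `M₁ = 3n/4` (FGG §4) -/

/-- The neighbours of `i` on the ring are `i + 1` and `i − 1` (`n ≥ 2`). [folklore] -/
private theorem neighborFinset_ringGraph (h2 : 2 ≤ n) (i : ZMod n) :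
    (ringGraph n).neighborFinset i = {i + 1, i - 1} := by
  ext j
  rw [SimpleGraph.mem_neighborFinset, Finset.mem_insert, Finset.mem_singleton]
  constructor
  · rintro ⟨-, h | h⟩
    · exact Or.inl h
    · exact Or.inr (by rw [h, add_sub_cancel_right])
  · rintro (rfl | rfl)
    · exact ringGraph_adj_add_one h2 i
    · have h := (ringGraph_adj_add_one h2 (i - 1)).symm
      rwa [sub_add_cancel] at h

/-- **The ring is `2`-regular** (`n ≥ 3`). [cite: FarhiGoldstoneGutmann2014, §4 (“2-regular connected
graphs on n vertices which is the ring”)] -/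
theorem ringGraph_isRegularOfDegree (h3 : 3 ≤ n) : (ringGraph n).IsRegularOfDegree 2 := by
  intro i
  rw [SimpleGraph.degree, neighborFinset_ringGraph (by omega), Finset.card_pair]
  intro h
  exact two_ne_zero_zmod h3 (by linear_combination h)

/-- **The ring has no triangles** (`n ≥ 4`), so WHJR's triangle-free `k`-regular level-1 formula applies
to it with `k = 2`. [cite: MbengFazioSantoro2019, §3 (the formula “valid for triangle-free k-regular
graphs … when specialized to k = 2, coincides with” the ring value)] -/
theorem ringGraph_cliqueFree_three (h4 : 4 ≤ n) : (ringGraph n).CliqueFree 3 := by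
  have h1 : (1 : ZMod n) ≠ 0 := one_ne_zero_zmod (by omega)
  have h3' : (3 : ZMod n) ≠ 0 := by
    intro h
    have h' : ((3 : ℕ) : ZMod n) = 0 := by exact_mod_cast h
    rw [ZMod.natCast_eq_zero_iff] at h'
    have := Nat.le_of_dvd (by norm_num) h'
    omega
  -- two ring-neighbours `b`, `c` of `a` (`b − a, c − a = ±1`, `b ≠ c`) are never adjacent
  have key : ∀ a b c : ZMod n, (ringGraph n).Adj a b → (ringGraph n).Adj a c → (ringGraph n).Adj b c →
      False := by
    rintro a b c ⟨-, hb | hb⟩ ⟨-, hc | hc⟩ ⟨hne, hbc | hbc⟩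
    all_goals first
      | exact hne (by linear_combination hb - hc)
      | exact hne (by linear_combination hc - hb)
      | exact h1 (by linear_combination hb - hc + hbc)
      | exact h1 (by linear_combination hc - hb - hbc)
      | exact h1 (by linear_combination hb + hc - hbc)
      | exact h1 (by linear_combination -hb - hc + hbc)
      | exact h1 (by linear_combination hb + hc + hbc)
      | exact h1 (by linear_combination -hb - hc - hbc)
      | exact h1 (by linear_combination hb - hc - hbc)
      | exact h1 (by linear_combination hc - hb + hbc)
      | exact h3' (by linear_combination hb - hc - hbc)
      | exact h3' (by linear_combination hc - hb + hbc)
      | exact h3' (by linear_combination -hb + hc - hbc)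
      | exact h3' (by linear_combination hb - hc + hbc)
      | exact h3' (by linear_combination -hb - hc - hbc)
  intro t ht
  rw [SimpleGraph.is3Clique_iff] at ht
  obtain ⟨a, b, c, hab, hac, hbc, -⟩ := ht
  exact key a b c hab hac hbc

/-- The ring has `n` edges (`n ≥ 3`). [cite: FarhiGoldstoneGutmann2014, §4] -/
theorem card_edgeFinset_ringGraph (h3 : 3 ≤ n) : #(ringGraph n).edgeFinset = n := by
  rw [edgeFinset_ringGraph (by omega), Finset.card_image_of_injective _ ?_, Finset.card_univ, ZMod.card]
  intro i j hij
  have hij : s(i, i + 1) = s(j, j + 1) := hij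
  rw [Sym2.eq_iff] at hij
  rcases hij with ⟨h, -⟩ | ⟨h1, h2⟩
  · exact h
  · exfalso
    exact two_ne_zero_zmod h3 (by linear_combination h2 - h1)

/-- `F₁(γ, β) = n · F_edge(d = 1; γ, β)` on the ring (`n ≥ 4`): every edge has the parameters
`(d, e, f) = (1, 1, 0)` of the parent file's Corollary 1. [cite: FarhiGoldstoneGutmann2014, §4]
[cite: WangHadfieldJiangRieffel2018, §3 Cor. 1 (the ring is triangle-free 2-regular)] -/
theorem meanCut_ringGraph_one (h4 : 4 ≤ n) (γ β : Fin 1 → ℝ) :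
    meanCut (ringGraph n) 1 γ β = n * regularEdge 1 (γ 0) (β 0) := by
  have h := levelP_eq_meanCut (ringGraph n) 1 γ β
  rw [levelP_one, levelOne_eq_of_regular_cliqueFree (ringGraph n) (ringGraph_isRegularOfDegree (by omega))
    (ringGraph_cliqueFree_three h4), card_edgeFinset_ringGraph (by omega)] at h
  exact_mod_cast h.symm

/-- **FGG §4, level 1 on the ring: `M₁ = 3n/4`** (`n ≥ 4`; attained at `(γ, β) = (π/4, π/8)`).
[cite: FarhiGoldstoneGutmann2014, §4 (“for p = 1, 2, 3, 4, 5 and 6 we have that the maxima are 3/4,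
5/6, …”)] -/
theorem maxLevel_ringGraph_one (h4 : 4 ≤ n) : maxLevel (ringGraph n) 1 = 3 * n / 4 := by
  refine le_antisymm (ciSup_le fun a => ?_) ?_
  · rw [meanCut_ringGraph_one h4]
    have h := regularEdge_one_le (a.1 0) (a.2 0)
    have hn : (0 : ℝ) ≤ n := Nat.cast_nonneg n
    nlinarith
  · have h := meanCut_le_maxLevel (ringGraph n) 1 (fun _ => Real.pi / 4) (fun _ => Real.pi / 8)
    rw [meanCut_ringGraph_one h4, regularEdge_one_optimal] at h
    linarith


/-! ### MaxCut of bipartite graphs and of the even ring; the bounds as approximation ratios -/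

omit [NeZero n] in
/-- **“Any bipartite graph with a set of edges `E` has maximum cut size `|E|`”**: a two-colouring with
adjacent vertices coloured differently cuts every edge. [cite: BravyiKlieschKoenigTang2020, §QAOA
(“Note that any bipartite graph with a set of edges E has maximum cut size |E|”)] -/
theorem maxCut_eq_card_of_twoColouring {W : Type*} [Fintype W] [DecidableEq W] (K : SimpleGraph W)
    [DecidableRel K.Adj] (c : W → Bool) (hc : ∀ a b, K.Adj a b → c a ≠ c b) :
    maxCut K = #K.edgeFinset := by
  refine le_antisymm (Finset.sup_le fun x _ => cutValue_le_card K x) ?_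
  have hcut : cutValue K c = #K.edgeFinset := by
    rw [cutValue, Finset.card_eq_sum_ones]
    refine Finset.sum_congr rfl fun e he => ?_
    induction e using Sym2.ind with
    | h a b => rw [cutInd_mk, if_neg (hc a b (SimpleGraph.mem_edgeFinset.1 he))]
  rw [← hcut]
  exact Finset.le_sup (f := cutValue K) (Finset.mem_univ c)

/-- Consecutive sites of an even ring get different parity colours. [folklore] -/
private theorem parityColour_ne (hn : Even n) (h2 : 2 ≤ n) (i : ZMod n) :
    decide (Even (ZMod.val i)) ≠ decide (Even (ZMod.val (i + 1))) := by
  have h := even_val_add_one hn h2 i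
  by_cases hi : Even (ZMod.val i)
  · rw [decide_eq_true hi, decide_eq_false (h.not.2 (not_not_intro hi))]
    decide
  · rw [decide_eq_false hi, decide_eq_true (h.2 hi)]
    decide

/-- **The even ring is bipartite, so its maximum cut is `n`** (“The maximum energy of `H_n` coincides
with the number of edges in the maximum cut”). [cite: BravyiKlieschKoenigTang2020, §QAOA (the ring of
disagrees with n even; “maximum cut size |E|”)] -/
theorem maxCut_ringGraph (hn : Even n) (h3 : 3 ≤ n) : maxCut (ringGraph n) = n := by
  rw [maxCut_eq_card_of_twoColouring (ringGraph n) (fun i => decide (Even (ZMod.val i))) ?_,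
    card_edgeFinset_ringGraph h3]
  rintro a b ⟨-, h | h⟩
  · rw [h]; exact parityColour_ne hn (by omega) a
  · rw [h]; exact (parityColour_ne hn (by omega) b).symm

/-- **BKKT Theorem 2 as an approximation ratio: `M_p ≤ ((2p + ½)/(2p + 1)) · MaxCut` on the even ring
with `4p < n`** (“the left-hand side … coincides with the approximation ratio, i.e., the ratio between
the expected value of the MaxCut cost function on the (optimal) level-p variational state and the
maximum cut size”). [cite: BravyiKlieschKoenigTang2020, Thm. 2 and §QAOA] -/
theorem maxLevel_ringGraph_le_ratio (hn : Even n) {p : ℕ} (hp : 0 < p) (hpn : 4 * p < n) :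
    maxLevel (ringGraph n) p ≤ (2 * p + 1 / 2) / (2 * p + 1) * maxCut (ringGraph n) := by
  rw [maxCut_ringGraph hn (by omega), mul_comm]
  exact maxLevel_ringGraph_le hn hp hpn

/-- **FGG §4 as an approximation ratio: `M₁ = ¾ · MaxCut` on the even ring, `n ≥ 4`.** [cite:
FarhiGoldstoneGutmann2014, §4 (p = 1 ring maximum 3/4)] [cite: BravyiKlieschKoenigTang2020, §QAOA
(“approximation ratio … and the maximum cut size”)] -/
theorem maxLevel_ringGraph_one_ratio (hn : Even n) (h4 : 4 ≤ n) :
    maxLevel (ringGraph n) 1 = 3 / 4 * maxCut (ringGraph n) := by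
  rw [maxCut_ringGraph hn (by omega), maxLevel_ringGraph_one h4]
  ring

end RingObstruction


end QAOA

end Literature.Computability.QuantumComplexity
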